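import Literature.NumberTheory.ComplexMultiplication.CasselmanHeckeCharacterCMStructureHolds
import HarnessLib

/-!
# Casselman's structure WITH Shimura reciprocity (19.10g), cell currency — from [Shimura1998] Thm. 18.6 and Prop. 26 alone
# (FLOOR-0 programme P5, block W5: the `DeterminesHeckeCharacter`-producer, cell half; HOME-only draft)

Cell `hodgecm-mathlib`, D-0183 FLOOR 0, programme P5, block W5 (A-plan1 (g17) GO 19:24:03Z; HOME-only, 0 propose, 0 names
booked).  Namespace `Literature.NumberTheory.ComplexMultiplication.Casselman` (as the ★ closer file
`CasselmanHeckeCharacterCMStructureHolds`).  THEOREMS ONLY; no definition, no named fact, no sorry.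

THE POINT.  The closed H21 cone exports Casselman's theorem [Shimura1998] Thm. 21.4 in FROBENIUS form
(`casselmanCore_of_facts` / `shimura1998_thm21_4_casselman`: «every arithmetic Frobenius at a good unramified `v` acts on `T_ℓ A₀`
as `T_ℓ(ι₀ π_v)`»), although its proof passes through SHIMURA RECIPROCITY (19.10g) for the descended structure — the output
`hrec` of ★ `cocycleDescent_holds` (= ★ `exists_uniformization_shimuraReciprocity_of_descent`, [Shimura1998] §21.4 proof
pp. 147–148 «`r₁(w)^σ = r₁(β(y)f(y)⁻¹w)`, that is, (19.10g) is satisfied»), which `twistedGaloisModel_of_thm18_6` then turns into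
the Frobenius sentence (`frobenius_of_shimuraReciprocity`).  This file EXPORTS the (19.10g) form: under the hypotheses of
Thm. 21.4 there is a structure `(A₀, ι₀)` of type `(K, Φ)` over `k`, a lattice `𝔞` and a uniformisation `ξ₁` of `(A₀, ι₀)` of type
`(K, Φ, 𝔞)` with `σ • ξ₁.r u = ξ₁.r v` whenever `σ = [y, k]` (`IsArtinLift`), `χ(y_𝐡) = τ₀ b` and `(b g(N_{k/K*}y)_𝐡⁻¹)(u mod 𝔞) = v`
— the third conjunct of the LANE's `DeterminesHeckeCharacter` (`SatisfiesShimuraReciprocity`, `DeterminesHeckeCharacter.lean`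
:104) up to the lane/cell currency dictionary (`k : IntermediateField ℚ ℂ` and `reflexNormFinitePart K Φ k` there; abstract
`k`, `[Algebra k ℂ]` and `reflexNormFinitePart K Φ K* ∘ ideleRelNorm K* k` here).  With that dictionary the ★ Lemma 19.12 file
`HeckeCharacterIsogenyRational` (`isIsogenous_of_determinesHeckeCharacter`) closes W5's kernel by name.

Proof = `casselmanCore_of_facts` VERBATIM up to `hrec` (structure over some number field by Prop. 26
`forall_exists_isCMTypeRealisationOver_uniformization_of_prop26`, the `λ`-family `exists_iso_conjugate_of_isArtinLift_of_thm18_6`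
(Thm. 18.6 (2)), cocycle descent `cocycleDescent_holds`, Weil descent with endomorphisms `AbelianVariety.exists_descent_with_end`),
then `hrec` itself instead of `frobenius_of_shimuraReciprocity`.

HC_CM is proved only modulo the 7 printed citations until rung 0 closes.

## References
* [Shimura1998] G. Shimura, *Abelian Varieties with Complex Multiplication and Modular Functions*, Princeton 1998: §21.4
  Thm. 21.4 and its proof (pp. 147–148: «(19.10g) is satisfied»); (19.10g) p. 136; §18.6 Thm. 18.6 (2);
  §12.4 Prop. 26; §21.1 Prop. 21.1.
-/

set_option autoImplicit false

noncomputable section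

open CategoryTheory IsDedekindDomain IsDedekindDomain.HeightOneSpectrum
open NumberField
open scoped NumberField ComplexConjugate nonZeroDivisors

namespace Literature.NumberTheory.ComplexMultiplication.Casselman

open Literature.AlgebraicGeometry.Motives
open Literature.NumberTheory.GaloisRepresentations
open Literature.NumberTheory.ComplexMultiplication
open Literature.NumberTheory.NumberFields.IdeleAction (ideleMulIdeal ideleMulEquiv)
open Literature.NumberTheory.AdelicBaseChange (ideleRelNorm)
open Literature.AlgebraicGeometry.ComplexMultiplication (IsCMTypeRealisation exists_isCMTypeRealisation)
open MonoidalCategory CartesianMonoidalCategory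
open scoped MonObj

/-- **Casselman's structure with Shimura reciprocity (19.10g) — from [Shimura1998] Prop. 26 and Thm. 18.6 as named facts.**
Under the hypotheses of Thm. 21.4 (`k ⊇ K*`, (19.10a) `ha`, (19.10b) `hb`/`hu`/`hπ`): a structure `(A₀, ι₀)` of type `(K, Φ)`
over `k`, a lattice `𝔞` and a uniformisation `ξ₁` of type `(K, Φ, 𝔞)` such that for every `σ ∈ Aut(ℂ/k)` with Artin lift
`y` and every `b ∈ K^×` with `χ(y_𝐡) = τ₀ b`: `σ • ξ₁.r u = ξ₁.r v` whenever `(b · g(N_{k/K*} y)_𝐡⁻¹)(u mod 𝔞) = v mod (…)𝔞`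
(«`r₁(w)^σ = r₁(β(y)f(y)⁻¹w)`, that is, (19.10g) is satisfied»).  Proof: `casselmanCore_of_facts` up to `hrec`.
[cite: Shimura1998, §21.4 Thm. 21.4 (proof, pp. 147–148); (19.10g) p. 136; §18.6 Thm. 18.6 (2); §12.4 Prop. 26; §21.1 Prop. 21.1] -/
theorem casselmanReciprocity_of_facts (h26 : shimura1998_prop26_definedOverNumberField) (h186 : shimura1998_thm18_6) :
    ∀ (k : Type) [Field k] [NumberField k] [Algebra k ℂ] (K : Type) [Field K] [NumberField K]
      [IsCMField K] (Φ : CMType K) (τ₀ : K →+* ℂ) (χ : HeckeCharacter k),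
    ((traceField Φ : Set ℂ) ⊆ Set.range (algebraMap k ℂ)) →
    χ.HasInfinityType (cmInfinityType Φ.1 τ₀ (algebraMap k ℂ)).1
      (cmInfinityType Φ.1 τ₀ (algebraMap k ℂ)).2 →
    (∀ x : ideleGroup k, (x : AdeleRing (𝓞 k) k).1 = 1 →
      (∃ b : K, ((χ x : ℂˣ) : ℂ) = τ₀ b) ∧
        ((χ x : ℂˣ) : ℂ) * conj ((χ x : ℂˣ) : ℂ) = (((ideleNorm x)⁻¹ : ℝ) : ℂ)) →
    (∀ (v : HeightOneSpectrum (𝓞 k)) (u : (v.adicCompletionIntegers k)ˣ),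
      ∃ b : (𝓞 K)ˣ, ((χ.localComponent v
        (Units.map ((v.adicCompletionIntegers k).subtype : _ →* _) u) : ℂˣ) : ℂ) =
        τ₀ ((b : 𝓞 K) : K)) →
    (∀ v : HeightOneSpectrum (𝓞 k), ∃ π : 𝓞 K, χ.valueAtUniformizer v = τ₀ (π : K) ∧
      ∀ (L : Type) [Field L] [NumberField L] [Normal ℚ L] (ιL : L →+* ℂ) (j : K →+* L)
        (σL : k →+* L), ιL.comp σL = algebraMap k ℂ →
        IsReflexTypeNorm (valuedIn ιL Φ.1) j σL v.asIdeal (Ideal.span {π})) →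
    ∃ (A₀ : AbelianVariety k) (ι₀ : 𝓞 K →+* End A₀) (𝔞 : (FractionalIdeal (𝓞 K)⁰ K)ˣ)
      (ξ₁ : CMTypeUniformization Φ 𝔞 A₀ ι₀),
      IsCMTypeRealisationOver Φ A₀ ι₀ ∧
      ∀ [NumberField ↥(traceField Φ)] [Algebra ↥(traceField Φ) k] [IsScalarTower ↥(traceField Φ) k ℂ]
        (σ : ℂ ≃ₐ[k] ℂ) (y : ideleGroup k), IsArtinLift k y σ →
        ∀ b : Kˣ, ((χ ((infiniteIdeles k (HeckeCharacter.infPart k y))⁻¹ * y) : ℂˣ) : ℂ) = τ₀ (b : K) →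
          ∀ u v : K,
            ideleMulEquiv (FiniteAdeleRing.unitEmbedding (𝓞 K) K b *
                (reflexNormFinitePart K Φ (traceField Φ) (ideleRelNorm (↥(traceField Φ)) k y))⁻¹)
              (𝔞 : FractionalIdeal (𝓞 K)⁰ K) 𝔞.ne_zero (Submodule.Quotient.mk u) = Submodule.Quotient.mk v →
            σ • ξ₁.r u = ξ₁.r v := by
  intro k _ _ _ K _ _ _ Φ τ₀ χ hK ha hb hu hπ
  obtain ⟨k₁, _i1, _i2, _i3, A₁, ι₁, hA₁, 𝔞, ⟨ξ⟩⟩ :=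
    Literature.AlgebraicGeometry.ComplexMultiplication.forall_exists_isCMTypeRealisationOver_uniformization_of_prop26
      h26 K Φ
  have hlam := @exists_iso_conjugate_of_isArtinLift_of_thm18_6 h186 k _ _ _ K _ _ _ Φ τ₀ χ hK ha hb hu hπ k₁ _ _ _
    A₁ ι₁ hA₁ 𝔞 ξ
  obtain ⟨k₂, _j1, _j2, _j3, _j4, _j5, _j6, _j7, A₂, ι₂, ρ, hρ, hA₂, hmul, hone, hinv, hιρ, hrec⟩ :=
    cocycleDescent_holds k K Φ τ₀ χ hK ha hb hu hπ k₁ A₁ ι₁ hA₁ 𝔞 ξ hlam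
  obtain ⟨A₀, e, ι₀, he, hι⟩ := AbelianVariety.exists_descent_with_end k₂ A₂ ρ hρ hmul hone hinv K ι₂ hιρ
  obtain ⟨ξ₁, hξ₁⟩ := hrec A₀ e he ι₀ hι
  have h₂' : IsCMTypeRealisationOver Φ (A₀.baseChange k₂) ((A₀.endBaseChange k₂).comp ι₀) :=
    (IsCMTypeRealisationOver.iff_of_iso e (fun a => by
      simpa only [RingHom.comp_apply, AbelianVariety.endBaseChange_apply] using hι a)).1 hA₂
  exact ⟨A₀, ι₀, 𝔞, ξ₁, IsCMTypeRealisationOver.of_baseChange h₂', hξ₁⟩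

/-- **Casselman's structure with Shimura reciprocity (19.10g) — UNCONDITIONAL** (Prop. 26 = ★
`shimura1998_prop26_definedOverNumberField_holds`, Thm. 18.6 = ★ `shimura1998_thm18_6_holds`).  The cell-currency half of the
`DeterminesHeckeCharacter` producer wanted by FLOOR-0 P5-W5 (A-plan1 (g17) 19:24:03Z); the lane half is the dictionary
`IntermediateField`/`reflexNormFinitePart K Φ k` ↔ abstract `k`/`reflexNormFinitePart K Φ K* ∘ ideleRelNorm`.
[cite: Shimura1998, §21.4 Thm. 21.4 (proof, pp. 147–148); (19.10g) p. 136; §18.6 Thm. 18.6 (2); §12.4 Prop. 26] -/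
theorem casselmanReciprocity_holds :
    ∀ (k : Type) [Field k] [NumberField k] [Algebra k ℂ] (K : Type) [Field K] [NumberField K]
      [IsCMField K] (Φ : CMType K) (τ₀ : K →+* ℂ) (χ : HeckeCharacter k),
    ((traceField Φ : Set ℂ) ⊆ Set.range (algebraMap k ℂ)) →
    χ.HasInfinityType (cmInfinityType Φ.1 τ₀ (algebraMap k ℂ)).1
      (cmInfinityType Φ.1 τ₀ (algebraMap k ℂ)).2 →
    (∀ x : ideleGroup k, (x : AdeleRing (𝓞 k) k).1 = 1 →
      (∃ b : K, ((χ x : ℂˣ) : ℂ) = τ₀ b) ∧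
        ((χ x : ℂˣ) : ℂ) * conj ((χ x : ℂˣ) : ℂ) = (((ideleNorm x)⁻¹ : ℝ) : ℂ)) →
    (∀ (v : HeightOneSpectrum (𝓞 k)) (u : (v.adicCompletionIntegers k)ˣ),
      ∃ b : (𝓞 K)ˣ, ((χ.localComponent v
        (Units.map ((v.adicCompletionIntegers k).subtype : _ →* _) u) : ℂˣ) : ℂ) =
        τ₀ ((b : 𝓞 K) : K)) →
    (∀ v : HeightOneSpectrum (𝓞 k), ∃ π : 𝓞 K, χ.valueAtUniformizer v = τ₀ (π : K) ∧
      ∀ (L : Type) [Field L] [NumberField L] [Normal ℚ L] (ιL : L →+* ℂ) (j : K →+* L)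
        (σL : k →+* L), ιL.comp σL = algebraMap k ℂ →
        IsReflexTypeNorm (valuedIn ιL Φ.1) j σL v.asIdeal (Ideal.span {π})) →
    ∃ (A₀ : AbelianVariety k) (ι₀ : 𝓞 K →+* End A₀) (𝔞 : (FractionalIdeal (𝓞 K)⁰ K)ˣ)
      (ξ₁ : CMTypeUniformization Φ 𝔞 A₀ ι₀),
      IsCMTypeRealisationOver Φ A₀ ι₀ ∧
      ∀ [NumberField ↥(traceField Φ)] [Algebra ↥(traceField Φ) k] [IsScalarTower ↥(traceField Φ) k ℂ]
        (σ : ℂ ≃ₐ[k] ℂ) (y : ideleGroup k), IsArtinLift k y σ →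
        ∀ b : Kˣ, ((χ ((infiniteIdeles k (HeckeCharacter.infPart k y))⁻¹ * y) : ℂˣ) : ℂ) = τ₀ (b : K) →
          ∀ u v : K,
            ideleMulEquiv (FiniteAdeleRing.unitEmbedding (𝓞 K) K b *
                (reflexNormFinitePart K Φ (traceField Φ) (ideleRelNorm (↥(traceField Φ)) k y))⁻¹)
              (𝔞 : FractionalIdeal (𝓞 K)⁰ K) 𝔞.ne_zero (Submodule.Quotient.mk u) = Submodule.Quotient.mk v →
            σ • ξ₁.r u = ξ₁.r v :=
  casselmanReciprocity_of_facts shimura1998_prop26_definedOverNumberField_holds shimura1998_thm18_6_holds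

/-! ## §2 (ed. 2) The lattice clause of (19.10b) in cell currency, and the three clauses packaged

[Shimura1998] Prop. 19.10 (19.10b) «`χ(x)𝔞 = f(x)𝔞`» for Casselman's `χ`: with `b = χ(y_𝐡)` read in `K` (`τ₀ b = χ(y_𝐡)`) and
`f(y) = g(N_{k/K*} y)_𝐡`, the principal idèle of `b` and `f(y)` move EVERY fractional ideal `𝔞` of `𝓞 K` to the same lattice —
immediate from ★ `spanSingleton_eq_toFractionalIdeal_reflexNormFinitePart_of_local` (`CasselmanBetaLattice`, «`(β(y)) = il(f(y))`»,
from the local readings `hu`, `hπ` of (19.10b)).  Together with §1 this gives, for Casselman's structure, ALL THREE clauses of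
«`(A₀, ι₀)` determines `χ`» — (19.10a) = the hypothesis `ha` itself, (19.10b) = `hb` + the lattice clause, (19.10g) = §1 — in CELL
currency (abstract `k` with `[Algebra k ℂ]`, reflex norm through `ideleRelNorm` to `K* = traceField Φ`); the LANE's
`DeterminesHeckeCharacter Φ k 𝔞 ξ τ₀ χ` (`k : IntermediateField ℚ ℂ`, `reflexNormFinitePart K Φ k`) is this up to the lane∕cell dictionary. -/

/-- **(19.10b), lattice clause, cell currency: `b𝔞 = f(y)𝔞` for every fractional ideal `𝔞`** — for every idèle `y` of `k` and
`b ∈ K^×` with `χ(y_𝐡) = τ₀ b`, the principal finite idèle of `b` and `f(y) = g(N_{k/K*} y)_𝐡` act identically on fractional ideals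
(`IdeleAction.ideleMulIdeal`), because `(b) = il(f(y))` (★ `spanSingleton_eq_toFractionalIdeal_reflexNormFinitePart_of_local`).
[cite: Shimura1998, Prop. 19.10 (19.10b) p. 135; §21.4 proof of Thm. 21.4 (pp. 147–148) («β(y)g(s)⁻¹𝔞 = 𝔞»)] -/
theorem ideleMulIdeal_unitEmbedding_eq_of_local
    {k : Type} [Field k] [NumberField k] [Algebra k ℂ] {K : Type} [Field K] [NumberField K] [IsCMField K]
    (Φ : CMType K) (τ₀ : K →+* ℂ) (χ : HeckeCharacter k)
    [NumberField ↥(traceField Φ)] [Algebra ↥(traceField Φ) k] [IsScalarTower ↥(traceField Φ) k ℂ]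
    (hu : ∀ (v : HeightOneSpectrum (𝓞 k)) (u : (v.adicCompletionIntegers k)ˣ),
      ∃ b : (𝓞 K)ˣ, ((χ.localComponent v
        (Units.map ((v.adicCompletionIntegers k).subtype : _ →* _) u) : ℂˣ) : ℂ) =
        τ₀ ((b : 𝓞 K) : K))
    (hπ : ∀ v : HeightOneSpectrum (𝓞 k), ∃ π : 𝓞 K, χ.valueAtUniformizer v = τ₀ (π : K) ∧
      ∀ (L : Type) [Field L] [NumberField L] [Normal ℚ L] (ιL : L →+* ℂ) (j : K →+* L)
        (σL : k →+* L), ιL.comp σL = algebraMap k ℂ →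
        IsReflexTypeNorm (valuedIn ιL Φ.1) j σL v.asIdeal (Ideal.span {π}))
    (y : ideleGroup k) (b : Kˣ)
    (hyb : ((χ ((infiniteIdeles k (HeckeCharacter.infPart k y))⁻¹ * y) : ℂˣ) : ℂ) = τ₀ (b : K))
    (𝔞 : FractionalIdeal (𝓞 K)⁰ K) :
    ideleMulIdeal (FiniteAdeleRing.unitEmbedding (𝓞 K) K b) 𝔞 =
      ideleMulIdeal (reflexNormFinitePart K Φ (traceField Φ) (ideleRelNorm (↥(traceField Φ)) k y)) 𝔞 := by
  rw [Literature.NumberTheory.NumberFields.IdeleAction.ideleMulIdeal_unitEmbedding,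
    Literature.NumberTheory.NumberFields.IdeleAction.ideleMulIdeal_def,
    spanSingleton_eq_toFractionalIdeal_reflexNormFinitePart_of_local Φ τ₀ χ hu hπ y hyb]

/-- **Casselman's structure DETERMINES `χ` — all three clauses of [Shimura1998] (19.10a)(19.10b)(19.10g) in cell currency,
UNCONDITIONAL.**  Under the five hypotheses of `shimura1998_thm21_4_casselman`: `(A₀, ι₀)` of type `(K, Φ)` over `k`, a lattice `𝔞`
and a uniformisation `ξ₁` with (g) Shimura reciprocity `σ • ξ₁.r u = ξ₁.r v` (§1) and (b) the lattice clause `b𝔟 = f(y)𝔟` for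
EVERY fractional ideal `𝔟` (in particular `𝔞`); (19.10a) is the hypothesis `ha` verbatim and (19.10b)'s value clauses are `hb`.
This is the cell-currency content of the lane's `DeterminesHeckeCharacter Φ k 𝔞 ξ₁ τ₀ χ` for Casselman's structure; with the
lane∕cell dictionary, ★ `HeckeCharacterIsogenyRational.isIsogenous_of_determinesHeckeCharacter` ([Shimura1998] Lemma 19.12) then
makes two such structures `k`-isogenous.
[cite: Shimura1998, Prop. 19.10 (19.10a,b) p. 135, (19.10g) p. 136; §21.4 Thm. 21.4 (proof, pp. 147–148); §19.12 Lemma 19.12] -/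
theorem casselmanDetermines_cell_holds :
    ∀ (k : Type) [Field k] [NumberField k] [Algebra k ℂ] (K : Type) [Field K] [NumberField K]
      [IsCMField K] (Φ : CMType K) (τ₀ : K →+* ℂ) (χ : HeckeCharacter k),
    ((traceField Φ : Set ℂ) ⊆ Set.range (algebraMap k ℂ)) →
    χ.HasInfinityType (cmInfinityType Φ.1 τ₀ (algebraMap k ℂ)).1
      (cmInfinityType Φ.1 τ₀ (algebraMap k ℂ)).2 →
    (∀ x : ideleGroup k, (x : AdeleRing (𝓞 k) k).1 = 1 →
      (∃ b : K, ((χ x : ℂˣ) : ℂ) = τ₀ b) ∧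
        ((χ x : ℂˣ) : ℂ) * conj ((χ x : ℂˣ) : ℂ) = (((ideleNorm x)⁻¹ : ℝ) : ℂ)) →
    (∀ (v : HeightOneSpectrum (𝓞 k)) (u : (v.adicCompletionIntegers k)ˣ),
      ∃ b : (𝓞 K)ˣ, ((χ.localComponent v
        (Units.map ((v.adicCompletionIntegers k).subtype : _ →* _) u) : ℂˣ) : ℂ) =
        τ₀ ((b : 𝓞 K) : K)) →
    (∀ v : HeightOneSpectrum (𝓞 k), ∃ π : 𝓞 K, χ.valueAtUniformizer v = τ₀ (π : K) ∧
      ∀ (L : Type) [Field L] [NumberField L] [Normal ℚ L] (ιL : L →+* ℂ) (j : K →+* L)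
        (σL : k →+* L), ιL.comp σL = algebraMap k ℂ →
        IsReflexTypeNorm (valuedIn ιL Φ.1) j σL v.asIdeal (Ideal.span {π})) →
    ∃ (A₀ : AbelianVariety k) (ι₀ : 𝓞 K →+* End A₀) (𝔞 : (FractionalIdeal (𝓞 K)⁰ K)ˣ)
      (ξ₁ : CMTypeUniformization Φ 𝔞 A₀ ι₀),
      IsCMTypeRealisationOver Φ A₀ ι₀ ∧
      (∀ [NumberField ↥(traceField Φ)] [Algebra ↥(traceField Φ) k] [IsScalarTower ↥(traceField Φ) k ℂ]
        (σ : ℂ ≃ₐ[k] ℂ) (y : ideleGroup k), IsArtinLift k y σ →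
        ∀ b : Kˣ, ((χ ((infiniteIdeles k (HeckeCharacter.infPart k y))⁻¹ * y) : ℂˣ) : ℂ) = τ₀ (b : K) →
          ∀ u v : K,
            ideleMulEquiv (FiniteAdeleRing.unitEmbedding (𝓞 K) K b *
                (reflexNormFinitePart K Φ (traceField Φ) (ideleRelNorm (↥(traceField Φ)) k y))⁻¹)
              (𝔞 : FractionalIdeal (𝓞 K)⁰ K) 𝔞.ne_zero (Submodule.Quotient.mk u) = Submodule.Quotient.mk v →
            σ • ξ₁.r u = ξ₁.r v) ∧
      (∀ [NumberField ↥(traceField Φ)] [Algebra ↥(traceField Φ) k] [IsScalarTower ↥(traceField Φ) k ℂ]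
        (y : ideleGroup k) (b : Kˣ),
        ((χ ((infiniteIdeles k (HeckeCharacter.infPart k y))⁻¹ * y) : ℂˣ) : ℂ) = τ₀ (b : K) →
          ∀ 𝔟 : FractionalIdeal (𝓞 K)⁰ K,
            ideleMulIdeal (FiniteAdeleRing.unitEmbedding (𝓞 K) K b) 𝔟 =
              ideleMulIdeal (reflexNormFinitePart K Φ (traceField Φ) (ideleRelNorm (↥(traceField Φ)) k y)) 𝔟) := by
  intro k _ _ _ K _ _ _ Φ τ₀ χ hK ha hb hu hπ
  obtain ⟨A₀, ι₀, 𝔞, ξ₁, hA₀, hrec⟩ := casselmanReciprocity_holds k K Φ τ₀ χ hK ha hb hu hπ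
  exact ⟨A₀, ι₀, 𝔞, ξ₁, hA₀, hrec, fun y b hyb 𝔟 =>
    ideleMulIdeal_unitEmbedding_eq_of_local Φ τ₀ χ hu hπ y b hyb 𝔟⟩

end Literature.NumberTheory.ComplexMultiplication.Casselman

end
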